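import Summits.QuantumFields.BalabanUV.T4Continuum.Support.NE9HoloFamilyVacuumSubtracted
import Summits.QuantumFields.BalabanUV.T4Continuum.Support.NE9FutureProfileEndOfRecordSP
import Summits.QuantumFields.BalabanUV.T4Continuum.Support.NE9VacuumSubtractedBridgeSharp

/-!
# NE9HoloFamilyCoupledEnd — route R4's ROOM yields the OCCUPATION of the record's tables (and the term-size bound) by
# itself; hence the coupling half `hlast` of the R4 END of record is DERIVED from the displayed coupling two-point letters
# WITHOUT an occupation hypothesis and WITHOUT size-induction data — the ♯-END of record with both halves in letters

Cell `pub-balaban`, T4-DAG §6 NE9; BINDER row NE9 OWNER lineage `b2b-balaban-t4-ne9-p1` gen 61, CRUX PROVER NE9 (ruling e34b3e0c (2));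
route R4 ∕ R4♯ of `t4/ROUTES-NE9.md` v7 (rank 1).  Item (γ) of the owner's g60 HANDOFF («the coupling half `hlast` by name») on
leaf lineage `…-leaf-06` gen 39's `NE9VacuumSubtractedBridgeSharp` (p256991 ✓; §1 = the binder (L) from COUPLING TWO-POINT data
`hCup` + channel coupling modulus `hTcup` + pencil + OCCUPATION `hocc`) and leaf lineage `…-leaf-05` gen 47's ♯-END
`NE9FutureProfileEndOfRecordSP.ne9_and_fadingMemory_of_holoSlice_sharp_SP` (p256694 ✓).
THE POINT (structural, [analysis] of the kernel — not of print).  On route R3′ the binder (L) needs the OCCUPATION of the record's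
tables in the inner ball (`hocc`), which END #1 derives from SIZE-INDUCTION data (`hbase`, `hNsucc`, `hNnn`, `hbox`; leaf-06's §3).
On route R4 the ROOM `ω̂·r + τ₀·B₀ ≤ θ·r` that drives the fading ALREADY confines the whole future-profile orbit to the ball of
radius `θ·r < r` (`NE9FutureProfileEnd.norm_emb_le`), and the orbit's profile coordinates ARE the record's weighted tables
(`NE9FutureProfileEndOfRecordSharp.orbit_of_record_injRead` (iii)); so (§1) the tables `reading (wt k) (T k s (E g))`, `g, s ∈ W`, lie
in `ball 0 r` and `TermSize E W κ (fun _ => B₀)` holds — from R4's END hypotheses MINUS `hlast`, with NO size-induction data.  Feeding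
§1 to leaf-06's (L) lemma gives (§3) the coupling half from the coupling two-point letters alone, and (§4) THE ♯-END OF RECORD ON THE
RECORD's NEW-TERM SHAPE WITH BOTH HALVES IN LETTERS: pencil (`hhol`∕`hsup`∕`hkp2`∕`hdec`∕`hpin`, every background incl. `U₀`) +
coupling two-point (`hCup` on `ball 0 s₀`, `hclip0`∕`hclipb`) + channel coupling modulus (`hTcup`, `hqT0`∕`hqTb`) + the record's shape
`hΨv` + `hexplZ`∕`hp₀` + structural binders + ROOM `ω̂·s₀ + τ̄·(2B + p̄₀) ≤ θ·s₀` ⊢ `NE9 ∧ FadingMemory` with `ℓ = 8·clipbar·B +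
2·B∕(R₀ − s₀)·qTbar` at rate `θ`, prefactor `1∕(1−θ²)`; (§5) the same at `Ψ := NE9EndApplied.ΨOf` (`rfl`).
HONEST FRAMING (T4-DAG PAGE 1).  Rung (B)+1 of the FINITE-VOLUME T⁴ programme — NOT infinite volume, NOT a mass gap, NOT Clay.  NE9
(`T4OutputRate.NE9` ∧ `FadingMemory`) is a cell NEW ESTIMATE, NOT PRINTED in [I] = [Balaban1987RG1] (CMP **109**), [II] =
[Balaban1988RG2Cluster] (CMP **116**), NOT PROVED for Bałaban's E^{(j)}: every theorem below is «NE9 ⇐ the named binders».  Displayed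
Bałaban-side inputs AFTER this file: the pencil ((R-0)[scope] «[II] Lemma 3 (2.38) read over Lemma 2's box» on `R₀` at every background
incl. `U₀`; `hkp2`, `hdec`, `hpin`), the COUPLING TWO-POINT `hCup` (the (B)-interior's coupling half (R-1a); NOT PRINTED as an inequality —
print has «C^∞ … (or analytic)» in `g_{j−1}`, [I] p. 263), the channel's coupling modulus `hTcup` (TYPE [II] (1.33)–(1.36) p. 9), `hexplZ`
(TYPE [I] (2.14) p. 268 ∕ [II] (2.41) p. 21), structural binders, ROOM; W1 = model O-NE9-1 untouched; spine 0∕9.  HONEST DEPENDENCY (cell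
line, verbatim): continuum YM on T⁴ ⇐ BetaPertH ∧ nine spine estimates (0/9 proved); BetaPertH ⇐ (D1) ∧ (D4) ∧ CAP+tail; G-an2-4
gates asym, D1 and NE2/3/4.  `FlowStep.BetaPertH`, (B), (B^μ) do not occur; [I]∕[II] for TYPES only (ABSOLUTE RULE).  0 def, 0 sorry.
Fewer displayed binders inside a CONDITIONAL END is not progress on the estimate itself; nothing of Bałaban's asserted.  References
(TYPES only): [Balaban1987RG1] CMP **109** (2.13)–(2.14) p. 268, p. 263, (0.23) p. 256; [Balaban1988RG2Cluster] CMP **116** (1.33)–(1.36)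
p. 9, (2.13)–(2.15) pp. 14–15, (2.38) p. 20, (2.40)–(2.41) p. 21; [FV1980] ch. V §5.  Summits-side NEW work; imports D6, p256694, p256991
BY NAME; modifies nothing.  Value = one displayed binder class (occupation ∕ size induction) shown IDLE on route R4, NOT summit progress.
-/

noncomputable section

namespace Summit.QuantumFields.BalabanUV.T4Continuum.NE9HoloFamilyCoupledEnd

open Metric Set ComplexConjugate
open scoped BigOperators ENNReal
open Literature.Probability.LatticeModels
open Literature.MathematicalPhysics.QuantumFieldTheory.Balaban1983to89
open Literature.MathematicalPhysics.QuantumFieldTheory.Balaban1983to89.T4OutputRate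
open Literature.MathematicalPhysics.QuantumFieldTheory.Balaban1983to89.T4ActivityLipschitz
open Literature.MathematicalPhysics.QuantumFieldTheory.Balaban1983to89.T4HistoryLipschitzRecursion
open Literature.MathematicalPhysics.QuantumFieldTheory.Balaban1983to89.T4HistoryLipschitzOuter
open Literature.MathematicalPhysics.QuantumFieldTheory.Balaban1983to89.T4HistoryLipschitzActivity
open Literature.MathematicalPhysics.QuantumFieldTheory.Balaban1983to89.T4HistoryLipschitzSegment
open Literature.MathematicalPhysics.QuantumFieldTheory.Balaban1983to89.T4HistoryLipschitzActivity (ClusterGeom)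
open Summit.QuantumFields.BalabanUV.T4Continuum.NE9EarleHamiltonChain Summit.QuantumFields.BalabanUV.T4Continuum.NE9FutureProfileStep
open Summit.QuantumFields.BalabanUV.T4Continuum.NE9FutureProfileEnd
open Summit.QuantumFields.BalabanUV.T4Continuum.NE9ChannelRealLinear
open Summit.QuantumFields.BalabanUV.T4Continuum.NE9SliceSpaceOfRecord
open Summit.QuantumFields.BalabanUV.T4Continuum.NE9ChannelReadingOfRecord
open Summit.QuantumFields.BalabanUV.T4Continuum.NE9ChannelReadingSharp
open Summit.QuantumFields.BalabanUV.T4Continuum.NE9TableReading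
open Summit.QuantumFields.BalabanUV.T4Continuum.NE9FutureProfileRecordPrelim
open Summit.QuantumFields.BalabanUV.T4Continuum.NE9FutureProfileEndOfRecordSharp
open Summit.QuantumFields.BalabanUV.T4Continuum.NE9FutureProfileEndOfRecordSP
open Summit.QuantumFields.BalabanUV.T4Continuum.NE9TwoPointKPOfPencil Summit.QuantumFields.BalabanUV.T4Continuum.NE9HoloSliceOfFamily
open Summit.QuantumFields.BalabanUV.T4Continuum.NE9HoloFamilyOfPencil Summit.QuantumFields.BalabanUV.T4Continuum.NE9FutureProfileReal
open Summit.QuantumFields.BalabanUV.T4Continuum.NE9HoloFamilyVacuumSubtracted (psiOf_eq_vac)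
open Summit.QuantumFields.BalabanUV.T4Continuum.NE9VacuumSubtractedBridgeSharp

variable {C : Carriers} (G : ClusterGeom C) {Bg : Type}

/-! ## §0 The pencil letters imply `PotentialKPG` -/

/-- [folklore] The pencil letters of `NE9TwoPointKPOfPencil` (`hhol`, `hsup` majorant `m` on `‖Q‖ < R₀`, `hkp2` = KP for `2m`) with
`a, d ≥ 0`, `0 < R₀` give the stadium route's `PotentialKPG W act m a d R₀` (KP for `m`): `m ≥ 0` from `hsup` at `Q = 0`. -/
theorem potentialKPG_of_pencil2 {Pot : Type*} [NormedAddCommGroup Pot] [NormedSpace ℂ Pot] {W : Set (ℕ → ℝ)}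
    {act : ℕ → ℝ → Bg → Pot → G.P → ℂ} {m : ℕ → ℝ → Bg → G.P → ℝ} {a d : G.P → ℝ} {R₀ : ℝ}
    (ha : ∀ γ, 0 ≤ a γ) (hd : ∀ γ, 0 ≤ d γ) (hR₀ : 0 < R₀)
    (hhol : ∀ g ∈ W, ∀ (k : ℕ) (U : Bg) (X : C.Dom), C.scale X = k + 1 →
      ∀ γ ∈ G.vol X, LineHolo (fun Q => act k (g k) U Q γ) R₀)
    (hsup : ∀ g ∈ W, ∀ (k : ℕ) (U : Bg) (X : C.Dom), C.scale X = k + 1 →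
      ∀ Q ∈ ball (0 : Pot) R₀, ∀ γ ∈ G.vol X, ‖act k (g k) U Q γ‖ ≤ m k (g k) U γ)
    (hkp2 : ∀ g ∈ W, ∀ (k : ℕ) (U : Bg) (X : C.Dom), C.scale X = k + 1 →
      ∀ γ ∈ G.vol X, ∑ γ' ∈ G.vol X with G.inc γ' γ, 2 * m k (g k) U γ' * Real.exp (a γ' + d γ') ≤ a γ) :
    G.PotentialKPG W act m a d R₀ := by
  refine ⟨ha, hd, fun g hg k U X hX => ⟨hhol g hg k U X hX, hsup g hg k U X hX, fun γ hγ => ?_⟩⟩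
  refine le_trans (Finset.sum_le_sum fun γ' hγ' => ?_) (hkp2 g hg k U X hX γ hγ)
  have hm0 : 0 ≤ m k (g k) U γ' :=
    (norm_nonneg _).trans (hsup g hg k U X hX 0 (mem_ball_self hR₀) γ' (Finset.mem_filter.mp hγ').1)
  nlinarith [Real.exp_pos (a γ' + d γ')]

section Room

variable {ι : Type} [Nonempty ι] {E : Functional C Bg} {W : Set (ℕ → ℝ)} {Adm : Set (Bg → C.Dom → ℝ)}
  {T : ℕ → (ℕ → ℝ) → (Bg → C.Dom → ℝ) → ι → ℝ} {Ψ : ℕ → ℝ → (ι → ℝ) → Bg → C.Dom → ℝ}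
  {κ : ℝ} {wt : ℕ → ι → ℝ} {τ : ℕ → ℕ → ℝ} {τbar ω ωh : ℝ}

/-! ## §1 The ROOM alone confines the record: term size and occupation (no `hlast`, no size induction) -/

omit G in
/-- **ROUTE R4's ROOM YIELDS THE TERM-SIZE BOUND AND THE OCCUPATION OF THE RECORD's TABLES.**  Hypotheses: the END of record's
structural binders, a reading constant `τ₀ ≥ 0` with `hRd`, (Φ-size) `hΦb`, (Φ-real) `hreal` and the ROOM `ω̂·r + τ₀·B₀ ≤ θ·r` (`θ < 1`)
— `NE9FutureProfileEndOfRecordSP.ne9_and_fadingMemory_of_holoSlice_injRead_of_chain`'s MINUS `hlast`∕`hlam` and MINUS any chain estimate.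
Conclusions: `TermSize E W κ (fun _ => B₀)` AND every weighted table of record `reading (wt k) (T k s (E g))`, `g, s ∈ W`, lies in the
OPEN ball of radius `r`.  Proof: `orbit_of_record_injRead` (i) at `k := scale X`; (iii) at `n = 0` identifies the table with a profile
coordinate of the orbit, of norm `≤ θ·r < r` by `norm_emb_le`.  So on route R4 the occupation that route R3′ takes from the size
induction is FREE. [cite: Balaban1987RG1, (2.13) p.268 and (0.23) p.256; Balaban1988RG2Cluster, (1.36) p.9] -/
theorem termSize_and_occupation_of_room
    (h0 : ∀ g ∈ W, ∀ (U : Bg) (X : C.Dom), C.scale X = 0 → E g U X = 0)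
    (hAdm : AdmissibleTerms E W Adm) (hres : AdmRestrict Adm) (hadd : ChannelAdditive Adm T) (hloc : ChannelLocal Adm T)
    (hstep : ChannelSizeAtStepNN Adm T κ wt τ) (hfac : Factorises E W T Ψ)
    (hsmul : ∀ (c : ℝ), ∀ H ∈ Adm, c • H ∈ Adm) (hne : Adm.Nonempty) (hwt : ∀ m y, 0 < wt m y)
    (hτ : ∀ k j, j ≤ k → 0 ≤ τ k j ∧ τ k j ≤ τbar * ω ^ (k - j)) (hω : 0 ≤ ω) (hωh : 0 < ωh) (hωωh : ω ≤ ωh)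
    {τ₀ : ℝ} (hτ₀ : 0 ≤ τ₀)
    (hRd : ∀ (j n : ℕ), ∀ s ∈ W,
      ‖RdAmb (κ := κ) hadd hres hstep hAdm.2 hsmul hne hwt (τ_nonneg hτ) (j + n) j s‖ ≤ τ₀ * ω ^ n)
    {ΦY : ℕ → ℝ → lp (fun _ : ι => ℂ) ∞ → lp (fun _ : Bg × C.Dom => ℂ) ∞} {r B₀ θ : ℝ} (hr : 0 < r)
    (hB₀ : 0 ≤ B₀) (hθ1 : θ < 1)
    (hΦb : ∀ k, ∀ g ∈ W, MapsTo (ΦY k (g k)) (ball (0 : lp (fun _ : ι => ℂ) ∞) r) (closedBall 0 B₀))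
    (hreal : ∀ k, ∀ g ∈ W, ∀ s ∈ W, reading (wt k) (T k s (E g)) ∈ ball (0 : lp (fun _ : ι => ℂ) ∞) r →
      ∀ (U : Bg) (X : C.Dom), (ΦY k (s k) (reading (wt k) (T k s (E g))) : Bg × C.Dom → ℂ) (U, X) =
        ((Real.exp (κ * C.d X) * restrictScale (k + 1) (Ψ k (s k) (T k s (E g))) U X : ℝ) : ℂ))
    (hroom : ωh * r + τ₀ * B₀ ≤ θ * r) :
    TermSize E W κ (fun _ => B₀) ∧
      ∀ g ∈ W, ∀ s ∈ W, ∀ k : ℕ, reading (wt k) (T k s (E g)) ∈ ball (0 : lp (fun _ : ι => ℂ) ∞) r := by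
  set J := injRead (W := W) (RdAmb (κ := κ) hadd hres hstep hAdm.2 hsmul hne hwt (τ_nonneg hτ)) hτ₀ hω hωh hωωh hRd
    with hJdef
  have hJ : ∀ k, ‖J k‖ ≤ τ₀ := fun k => norm_injRead_le _ hτ₀ hω hωh hωωh hRd k
  have hθr : θ * r < r := by nlinarith
  have he₀ : ‖(0 : lp (fun _ : Bg × C.Dom => ℂ) ∞ × Fut W (lp (fun _ : ι => ℂ) ∞))‖ ≤ θ * r := by
    rw [norm_zero]; nlinarith [mul_nonneg hτ₀ hB₀, mul_pos hωh hr]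
  have horb := fun (g : ℕ → ℝ) (hg : g ∈ W) (k : ℕ) =>
    orbit_of_record_injRead h0 hAdm hres hadd hloc hstep hfac hsmul hne hwt hτ hω hωh hωωh hτ₀ hRd hr hB₀ hθ1 hΦb hreal
      hroom hg k
  refine ⟨fun g hg U X => (horb g hg (C.scale X)).1 U X le_rfl, fun g hg s hs k => ?_⟩
  have hF1 : (emb W ΦY J τ₀ ωh 0 k g).2 ⟨0, ⟨s, hs⟩⟩ = reading (wt k) (T k s (E g)) := by
    have h1 := (horb g hg k).2.2 0 s hs
    have hT : T (k + 0) s (truncScale k (E g)) = T k s (E g) := by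
      funext y; rw [Nat.add_zero]; exact (hloc k s (E g) (hAdm.1 g hg) y).symm
    rw [pow_zero, one_smul, hT] at h1
    simpa only [Nat.add_zero] using h1
  rw [← hF1, mem_ball_zero_iff]
  exact lt_of_le_of_lt (((emb W ΦY J τ₀ ωh 0 k g).2.norm_coe_le_norm _).trans
    ((norm_snd_le _).trans (norm_emb_le (fun k g hg => mapsTo_step hτ₀ hωh.le hΦb hJ hroom k hg) hθr he₀ k hg))) hθr

/-! ## §2 The three clauses of the vacuum-subtracted holomorphic slice (D6 §2's blocks, packed once) -/

omit [Nonempty ι] in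
/-- [folklore] **(Φ-holo) ∕ (Φ-size) ∕ (Φ-real) FOR THE VACUUM-SUBTRACTED SLICE** `holoSlice κ σ Φc`, `Φc k s Q U X := newTerm act k s U X Q
− newTerm act k s U₀ X Q + explZ k U X`, on `ball 0 s₀` with budget `2B + p̄₀`: from the pencil letters (every background incl. `U₀`), the
record's shape `hΨv`, `hexplZ`∕`hp₀`, and a conjugation `σ` fixing the weighted readings of real tables — the three blocks of
`NE9HoloFamilyVacuumSubtracted.ne9_and_fadingMemory_of_pencil_EH_vac`'s proof through `holoSlice_differentiableOn`∕`holoSlice_mapsTo`∕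
`holoSlice_real`. [cite: Balaban1987RG1, (2.13)-(2.14) p.268; Balaban1988RG2Cluster, Lemma 3 (2.38) p.20 and (2.40)-(2.41) p.21] -/
theorem vacSlice_clauses {σ : lp (fun _ : ι => ℂ) ∞ →L[ℝ] lp (fun _ : ι => ℂ) ∞}
    (hσ : ∀ (c : ℂ) (x : lp (fun _ : ι => ℂ) ∞), σ (c • x) = conj c • σ x) (hiso : ∀ x, ‖σ x‖ = ‖x‖)
    (hfixρ : ∀ (k : ℕ) (P : ι → ℝ), σ (reading (wt k) P) = reading (wt k) P)
    {act : ℕ → ℝ → Bg → lp (fun _ : ι => ℂ) ∞ → G.P → ℂ} {m : ℕ → ℝ → Bg → G.P → ℝ} {a d : G.P → ℝ}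
    {δ : C.Dom → ℝ} {U₀ : Bg} {explZ : ℕ → Bg → C.Dom → ℝ} {p₀ : ℕ → ℝ} {R₀ s₀ B pbar : ℝ}
    (ha : ∀ γ, 0 ≤ a γ) (hd : ∀ γ, 0 ≤ d γ) (hsR : s₀ < R₀) (hB : 0 ≤ B) (hpbar : 0 ≤ pbar)
    (hhol : ∀ g ∈ W, ∀ (k : ℕ) (U : Bg) (X : C.Dom), C.scale X = k + 1 →
      ∀ γ ∈ G.vol X, LineHolo (fun Q => act k (g k) U Q γ) R₀)
    (hsup : ∀ g ∈ W, ∀ (k : ℕ) (U : Bg) (X : C.Dom), C.scale X = k + 1 →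
      ∀ Q ∈ ball (0 : lp (fun _ : ι => ℂ) ∞) R₀, ∀ γ ∈ G.vol X, ‖act k (g k) U Q γ‖ ≤ m k (g k) U γ)
    (hkp2 : ∀ g ∈ W, ∀ (k : ℕ) (U : Bg) (X : C.Dom), C.scale X = k + 1 →
      ∀ γ ∈ G.vol X, ∑ γ' ∈ G.vol X with G.inc γ' γ, 2 * m k (g k) U γ' * Real.exp (a γ' + d γ') ≤ a γ)
    (hdec : G.DecayExtract δ d) (hpin : G.PinBudget a δ (fun _ => B) κ)
    (hΨv : ∀ (k : ℕ) (s : ℝ) (P : ι → ℝ) (U : Bg) (X : C.Dom),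
      Ψ k s P U X = (G.newTerm act k s U X (reading (wt k) P)).re - (G.newTerm act k s U₀ X (reading (wt k) P)).re +
        explZ k U X)
    (hexplZ : ∀ (k : ℕ) (U : Bg) (X : C.Dom), C.scale X = k + 1 → |explZ k U X| ≤ Real.exp (-(κ * C.d X)) * p₀ k)
    (hp₀ : ∀ k, p₀ k ≤ pbar) :
    (∀ k, ∀ g ∈ W, DifferentiableOn ℂ
      (holoSlice κ σ (fun k s Q U X => G.newTerm act k s U X Q - G.newTerm act k s U₀ X Q + ((explZ k U X : ℝ) : ℂ)) k (g k))
      (ball (0 : lp (fun _ : ι => ℂ) ∞) s₀)) ∧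
    (∀ k, ∀ g ∈ W, MapsTo
      (holoSlice κ σ (fun k s Q U X => G.newTerm act k s U X Q - G.newTerm act k s U₀ X Q + ((explZ k U X : ℝ) : ℂ)) k (g k))
      (ball (0 : lp (fun _ : ι => ℂ) ∞) s₀) (closedBall 0 (2 * B + pbar))) ∧
    (∀ k, ∀ g ∈ W, ∀ s ∈ W, reading (wt k) (T k s (E g)) ∈ ball (0 : lp (fun _ : ι => ℂ) ∞) s₀ →
      ∀ (U : Bg) (X : C.Dom),
        (holoSlice κ σ (fun k s Q U X => G.newTerm act k s U X Q - G.newTerm act k s U₀ X Q + ((explZ k U X : ℝ) : ℂ))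
            k (s k) (reading (wt k) (T k s (E g))) : Bg × C.Dom → ℂ) (U, X) =
          ((Real.exp (κ * C.d X) * restrictScale (k + 1) (Ψ k (s k) (T k s (E g))) U X : ℝ) : ℂ)) := by
  set Φc : ℕ → ℝ → lp (fun _ : ι => ℂ) ∞ → Bg → C.Dom → ℂ := fun k s Q U X =>
    G.newTerm act k s U X Q - G.newTerm act k s U₀ X Q + ((explZ k U X : ℝ) : ℂ) with hΦc
  have hball : ball (0 : lp (fun _ : ι => ℂ) ∞) s₀ ⊆ ball 0 R₀ := ball_subset_ball hsR.le
  have hball' : ball (0 : lp (fun _ : ι => ℂ) ∞) s₀ ⊆ closedBall 0 s₀ := ball_subset_closedBall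
  have hB₁ : 0 ≤ 2 * B + pbar := by positivity
  -- (c-holo): two Fréchet-holomorphic cluster sums and a constant
  have hcd : ∀ k, ∀ g ∈ W, ∀ (U : Bg) (X : C.Dom), C.scale X = k + 1 →
      DifferentiableOn ℂ (fun Q => Φc k (g k) Q U X) (ball 0 s₀) := by
    intro k g hg U X hX
    exact (((differentiableOn_newTerm G hd (hhol g hg k U X hX) (hsup g hg k U X hX) (hkp2 g hg k U X hX)).mono
      hball).sub ((differentiableOn_newTerm G hd (hhol g hg k U₀ X hX) (hsup g hg k U₀ X hX)
        (hkp2 g hg k U₀ X hX)).mono hball)).add (differentiableOn_const _)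
  -- (c-size): pin budget twice + the explicit part's letter
  have hcb : ∀ k, ∀ g ∈ W, ∀ (U : Bg) (X : C.Dom), C.scale X = k + 1 →
      ∀ Q ∈ ball (0 : lp (fun _ : ι => ℂ) ∞) s₀, ‖Φc k (g k) Q U X‖ ≤ Real.exp (-(κ * C.d X)) * (2 * B + pbar) := by
    intro k g hg U X hX Q hQ
    have h1 := norm_newTerm_le_of_pencil G ha hd hsR hhol hsup hkp2 hdec hpin hg (U := U) hX (hball' hQ)
    have h2 := norm_newTerm_le_of_pencil G ha hd hsR hhol hsup hkp2 hdec hpin hg (U := U₀) hX (hball' hQ)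
    have h3 := (hexplZ k U X hX).trans (mul_le_mul_of_nonneg_left (hp₀ k) (Real.exp_pos _).le)
    calc ‖Φc k (g k) Q U X‖
        ≤ ‖G.newTerm act k (g k) U X Q‖ + ‖G.newTerm act k (g k) U₀ X Q‖ + ‖((explZ k U X : ℝ) : ℂ)‖ :=
          (norm_add_le _ _).trans (add_le_add (norm_sub_le _ _) le_rfl)
      _ ≤ B * Real.exp (-(κ * C.d X)) + B * Real.exp (-(κ * C.d X)) + Real.exp (-(κ * C.d X)) * pbar := by
          refine add_le_add (add_le_add h1 h2) ?_
          rw [Complex.norm_real, Real.norm_eq_abs]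
          exact h3
      _ = Real.exp (-(κ * C.d X)) * (2 * B + pbar) := by ring
  -- (c-real): EXACT
  have hcre : ∀ k, ∀ g ∈ W, ∀ s ∈ W, ∀ (U : Bg) (X : C.Dom), C.scale X = k + 1 →
      Ψ k (s k) (T k s (E g)) U X = (Φc k (s k) (reading (wt k) (T k s (E g))) U X).re := by
    intro k g _ s _ U X _
    rw [hΨv]
    simp only [hΦc, Complex.add_re, Complex.sub_re, Complex.ofReal_re]
  exact ⟨fun k g hg => holoSlice_differentiableOn hσ hiso hB₁ (hcd k g hg) (hcb k g hg),
    fun k g hg => holoSlice_mapsTo hσ hiso hB₁ (hcd k g hg) (hcb k g hg),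
    holoSlice_real hσ hiso hfixρ hB₁ hcd hcb hcre⟩

/-! ## §3 The coupling half (L) on route R4: from the coupling two-point letters, occupation supplied by the ROOM -/

/-- **`LastCouplingLipschitz` ON ROUTE R4 FROM COUPLING TWO-POINT DATA — NO OCCUPATION HYPOTHESIS, NO SIZE INDUCTION.**  Displayed
inputs: structural binders; pencil letters (`hhol`∕`hsup`∕`hkp2` at every background incl. `U₀`, `hdec`, `hpin` budget `B`); the record's
shape `hΨv` + `hexplZ`∕`hp₀`; the COUPLING TWO-POINT `hCup` on `ball 0 s₀` with the pencil's majorant at the second coupling (NOT PRINTED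
as an inequality), `clip k ≥ 0`; the channel's coupling modulus `hTcup`, `qT k ≥ 0`; the ROOM `ω̂·s₀ + τ̄·(2B + p̄₀) ≤ θ·s₀`, `0 < s₀ <
R₀`, `θ < 1`.  Conclusion: `LastCouplingLipschitz E W T Ψ κ (fun k => 8·clip k·B + 2·B∕(R₀ − s₀)·qT k)`.  Proof: leaf-06's
`lastCouplingLipschitz_of_couplingTwoPoint_vacSub_sharp` with `𝒜 k := ball 0 s₀`, `ρ k := reading (wt k)` (`hρ` = `norm_reading_sub_le`),
`TwoPointKP` from the pencil (`twoPointKP_of_lineHolo_ball`), `PotentialKPG` by §0, occupation by §1 on the slice of §2 (σ = `star`).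
[cite: Balaban1987RG1, p.263 (1.18) and (2.13)-(2.14) p.268; Balaban1988RG2Cluster, (1.36) p.9, Lemma 3 (2.38) p.20, (2.40)-(2.41) p.21] -/
theorem lastCouplingLipschitz_of_couplingTwoPoint_room
    (h0 : ∀ g ∈ W, ∀ (U : Bg) (X : C.Dom), C.scale X = 0 → E g U X = 0)
    (hAdm : AdmissibleTerms E W Adm) (hres : AdmRestrict Adm) (hadd : ChannelAdditive Adm T) (hloc : ChannelLocal Adm T)
    (hstep : ChannelSizeAtStepNN Adm T κ wt τ) (hfac : Factorises E W T Ψ)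
    (hsmul : ∀ (c : ℝ), ∀ H ∈ Adm, c • H ∈ Adm) (hne : Adm.Nonempty) (hwt : ∀ m y, 0 < wt m y)
    (hτ : ∀ k j, j ≤ k → 0 ≤ τ k j ∧ τ k j ≤ τbar * ω ^ (k - j)) (hτbar : 0 < τbar) (hω : 0 ≤ ω) (hωh : 0 < ωh)
    (hωωh : ω ≤ ωh)
    {act : ℕ → ℝ → Bg → lp (fun _ : ι => ℂ) ∞ → G.P → ℂ} {m : ℕ → ℝ → Bg → G.P → ℝ} {a d : G.P → ℝ}
    {δ : C.Dom → ℝ} {U₀ : Bg} {explZ : ℕ → Bg → C.Dom → ℝ} {p₀ clip qT : ℕ → ℝ} {R₀ s₀ B pbar θ : ℝ}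
    (ha : ∀ γ, 0 ≤ a γ) (hd : ∀ γ, 0 ≤ d γ) (hs₀ : 0 < s₀) (hsR : s₀ < R₀)
    (hB : 0 ≤ B) (hpbar : 0 ≤ pbar) (hθ1 : θ < 1)
    (hhol : ∀ g ∈ W, ∀ (k : ℕ) (U : Bg) (X : C.Dom), C.scale X = k + 1 →
      ∀ γ ∈ G.vol X, LineHolo (fun Q => act k (g k) U Q γ) R₀)
    (hsup : ∀ g ∈ W, ∀ (k : ℕ) (U : Bg) (X : C.Dom), C.scale X = k + 1 →
      ∀ Q ∈ ball (0 : lp (fun _ : ι => ℂ) ∞) R₀, ∀ γ ∈ G.vol X, ‖act k (g k) U Q γ‖ ≤ m k (g k) U γ)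
    (hkp2 : ∀ g ∈ W, ∀ (k : ℕ) (U : Bg) (X : C.Dom), C.scale X = k + 1 →
      ∀ γ ∈ G.vol X, ∑ γ' ∈ G.vol X with G.inc γ' γ, 2 * m k (g k) U γ' * Real.exp (a γ' + d γ') ≤ a γ)
    (hdec : G.DecayExtract δ d) (hpin : G.PinBudget a δ (fun _ => B) κ)
    (hΨv : ∀ (k : ℕ) (s : ℝ) (P : ι → ℝ) (U : Bg) (X : C.Dom),
      Ψ k s P U X = (G.newTerm act k s U X (reading (wt k) P)).re - (G.newTerm act k s U₀ X (reading (wt k) P)).re +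
        explZ k U X)
    (hexplZ : ∀ (k : ℕ) (U : Bg) (X : C.Dom), C.scale X = k + 1 → |explZ k U X| ≤ Real.exp (-(κ * C.d X)) * p₀ k)
    (hp₀ : ∀ k, p₀ k ≤ pbar) (hclip0 : ∀ k, 0 ≤ clip k)
    (hCup : ∀ g ∈ W, ∀ g' ∈ W, ∀ (k : ℕ) (U : Bg) (X : C.Dom), C.scale X = k + 1 →
      ∀ Q ∈ ball (0 : lp (fun _ : ι => ℂ) ∞) s₀, ∀ γ ∈ G.vol X,
        ‖act k (g k) U Q γ‖ ≤ m k (g' k) U γ ∧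
          ‖act k (g k) U Q γ - act k (g' k) U Q γ‖ ≤ clip k * |g k - g' k| * m k (g' k) U γ)
    (hqT0 : ∀ k, 0 ≤ qT k)
    (hTcup : ∀ g ∈ W, ∀ g' ∈ W, ∀ (k : ℕ) (y : ι), |T k g (E g) y - T k g' (E g) y| ≤ wt k y * (qT k * |g k - g' k|))
    (hroom : ωh * s₀ + τbar * (2 * B + pbar) ≤ θ * s₀) :
    LastCouplingLipschitz E W T Ψ κ (fun k => 8 * clip k * B + 2 * B / (R₀ - s₀) * qT k) := by
  obtain ⟨σ, hσa, hσ, hiso⟩ := exists_star_clm_lp (ι := ι)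
  have hfixρ : ∀ (k : ℕ) (P : ι → ℝ), σ (reading (wt k) P) = reading (wt k) P := fun k P => by
    rw [hσa]; exact (isSelfAdjoint_reading (wt k) P).star_eq
  obtain ⟨-, hΦb, hreal⟩ := vacSlice_clauses G (W := W) (E := E) (T := T) (Ψ := Ψ) (κ := κ) hσ hiso hfixρ ha hd hsR hB
    hpbar hhol hsup hkp2 hdec hpin hΨv hexplZ hp₀
  -- occupation of the record's tables, from the ROOM (§1 at `τ₀ := τ̄`, sharp readings)
  obtain ⟨-, hocc⟩ := termSize_and_occupation_of_room h0 hAdm hres hadd hloc hstep hfac hsmul hne hwt hτ hω hωh hωωh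
    hτbar.le (fun j n s _ => norm_RdAmb_le_geometric_sharp (τ_geom hτ) j n s) hs₀ (by positivity) hθ1 hΦb hreal hroom
  have hR₀ : 0 < R₀ := hs₀.trans hsR
  have h𝒜 : ∀ k : ℕ, (fun _ : ℕ => ball (0 : lp (fun _ : ι => ℂ) ∞) s₀) k ⊆ closedBall 0 s₀ := fun _ => ball_subset_closedBall
  have hK := twoPointKP_of_lineHolo_ball G (𝒜 := fun _ => ball (0 : lp (fun _ : ι => ℂ) ∞) s₀) ha hd hsR h𝒜 hhol hsup hkp2
  have hKP := potentialKPG_of_pencil2 G ha hd hR₀ hhol hsup hkp2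
  exact lastCouplingLipschitz_of_couplingTwoPoint_vacSub_sharp G (fun k => reading (wt k)) U₀ explZ hK hKP hsR h𝒜 hclip0 hCup
    hdec hpin (fun k P P' M h => norm_reading_sub_le (hwt k) h) hΨv hqT0 hTcup (fun g hg g' hg' k => hocc g hg g' hg' k)

/-! ## §4 THE ♯-END OF RECORD WITH BOTH HALVES IN LETTERS (pencil + coupling two-point), route R4 -/

/-- **ROUTE R4♯'s END OF RECORD ON THE RECORD's NEW-TERM SHAPE, COUPLING HALF DERIVED.**  Hypotheses: those of
`NE9HoloFamilyVacuumSubtracted.ne9_and_fadingMemory_of_pencil_EH_vac_star` (structural binders; pencil letters at every background incl.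
`U₀`; the record's shape `hΨv`; `hexplZ`∕`hp₀`; ROOM `ω̂·s₀ + τ̄·(2B + p̄₀) ≤ θ·s₀`, `0 < s₀ < R₀`, `0 < θ < 1`) with the displayed
coupling half `hlast`∕`hlam` REPLACED by the coupling two-point letters `hCup` (on `ball 0 s₀`), `hclip0`∕`hclipb` and the channel's
coupling modulus `hTcup`, `hqT0`∕`hqTb`.  NO occupation hypothesis, NO size-induction data, NO `hρ`.  Conclusion: `NE9 ∧ FadingMemory`
with `prodModuli ((1∕(1−θ²))·ℓ) (fun _ => θ)`, `ℓ = 8·clipbar·B + 2·B∕(R₀ − s₀)·qTbar`.  Proof: §3 ⊕ §2 ⊕ leaf-05's ♯-END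
`ne9_and_fadingMemory_of_holoSlice_sharp_SP`.  «NE9 ⇐ the named binders»; W1 (model O-NE9-1) and (R-0)[scope] untouched.
[cite: Balaban1987RG1, (2.13)-(2.14) p.268 and p.263; Balaban1988RG2Cluster, (1.33)-(1.36) p.9, Lemma 3 (2.38) p.20, (2.40)-(2.41) p.21; FV1980, ch.V §5] -/
theorem ne9_and_fadingMemory_of_pencil_coupling_SP_vac
    (h0 : ∀ g ∈ W, ∀ (U : Bg) (X : C.Dom), C.scale X = 0 → E g U X = 0)
    (hAdm : AdmissibleTerms E W Adm) (hres : AdmRestrict Adm) (hadd : ChannelAdditive Adm T) (hloc : ChannelLocal Adm T)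
    (hstep : ChannelSizeAtStepNN Adm T κ wt τ) (hfac : Factorises E W T Ψ)
    (hsmul : ∀ (c : ℝ), ∀ H ∈ Adm, c • H ∈ Adm) (hne : Adm.Nonempty) (hwt : ∀ m y, 0 < wt m y)
    (hτ : ∀ k j, j ≤ k → 0 ≤ τ k j ∧ τ k j ≤ τbar * ω ^ (k - j)) (hτbar : 0 < τbar) (hω : 0 ≤ ω) (hωh : 0 < ωh)
    (hωωh : ω ≤ ωh)
    {act : ℕ → ℝ → Bg → lp (fun _ : ι => ℂ) ∞ → G.P → ℂ} {m : ℕ → ℝ → Bg → G.P → ℝ} {a d : G.P → ℝ}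
    {δ : C.Dom → ℝ} {U₀ : Bg} {explZ : ℕ → Bg → C.Dom → ℝ} {p₀ clip qT : ℕ → ℝ} {R₀ s₀ B pbar θ clipbar qTbar : ℝ}
    (ha : ∀ γ, 0 ≤ a γ) (hd : ∀ γ, 0 ≤ d γ) (hs₀ : 0 < s₀) (hsR : s₀ < R₀)
    (hB : 0 ≤ B) (hpbar : 0 ≤ pbar) (hθ0 : 0 < θ) (hθ1 : θ < 1)
    (hhol : ∀ g ∈ W, ∀ (k : ℕ) (U : Bg) (X : C.Dom), C.scale X = k + 1 →
      ∀ γ ∈ G.vol X, LineHolo (fun Q => act k (g k) U Q γ) R₀)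
    (hsup : ∀ g ∈ W, ∀ (k : ℕ) (U : Bg) (X : C.Dom), C.scale X = k + 1 →
      ∀ Q ∈ ball (0 : lp (fun _ : ι => ℂ) ∞) R₀, ∀ γ ∈ G.vol X, ‖act k (g k) U Q γ‖ ≤ m k (g k) U γ)
    (hkp2 : ∀ g ∈ W, ∀ (k : ℕ) (U : Bg) (X : C.Dom), C.scale X = k + 1 →
      ∀ γ ∈ G.vol X, ∑ γ' ∈ G.vol X with G.inc γ' γ, 2 * m k (g k) U γ' * Real.exp (a γ' + d γ') ≤ a γ)
    (hdec : G.DecayExtract δ d) (hpin : G.PinBudget a δ (fun _ => B) κ)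
    (hΨv : ∀ (k : ℕ) (s : ℝ) (P : ι → ℝ) (U : Bg) (X : C.Dom),
      Ψ k s P U X = (G.newTerm act k s U X (reading (wt k) P)).re - (G.newTerm act k s U₀ X (reading (wt k) P)).re +
        explZ k U X)
    (hexplZ : ∀ (k : ℕ) (U : Bg) (X : C.Dom), C.scale X = k + 1 → |explZ k U X| ≤ Real.exp (-(κ * C.d X)) * p₀ k)
    (hp₀ : ∀ k, p₀ k ≤ pbar) (hclip0 : ∀ k, 0 ≤ clip k) (hclipb : ∀ k, clip k ≤ clipbar)
    (hCup : ∀ g ∈ W, ∀ g' ∈ W, ∀ (k : ℕ) (U : Bg) (X : C.Dom), C.scale X = k + 1 →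
      ∀ Q ∈ ball (0 : lp (fun _ : ι => ℂ) ∞) s₀, ∀ γ ∈ G.vol X,
        ‖act k (g k) U Q γ‖ ≤ m k (g' k) U γ ∧
          ‖act k (g k) U Q γ - act k (g' k) U Q γ‖ ≤ clip k * |g k - g' k| * m k (g' k) U γ)
    (hqT0 : ∀ k, 0 ≤ qT k) (hqTb : ∀ k, qT k ≤ qTbar)
    (hTcup : ∀ g ∈ W, ∀ g' ∈ W, ∀ (k : ℕ) (y : ι), |T k g (E g) y - T k g' (E g) y| ≤ wt k y * (qT k * |g k - g' k|))
    (hroom : ωh * s₀ + τbar * (2 * B + pbar) ≤ θ * s₀) :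
    NE9 E W κ (prodModuli (1 / (1 - θ ^ 2) * (8 * clipbar * B + 2 * B / (R₀ - s₀) * qTbar)) fun _ => θ) ∧
      FadingMemory (1 / (1 - θ ^ 2) * (8 * clipbar * B + 2 * B / (R₀ - s₀) * qTbar) / θ) θ
        (prodModuli (1 / (1 - θ ^ 2) * (8 * clipbar * B + 2 * B / (R₀ - s₀) * qTbar)) fun _ => θ) := by
  obtain ⟨σ, hσa, hσ, hiso⟩ := exists_star_clm_lp (ι := ι)
  have hfixρ : ∀ (k : ℕ) (P : ι → ℝ), σ (reading (wt k) P) = reading (wt k) P := fun k P => by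
    rw [hσa]; exact (isSelfAdjoint_reading (wt k) P).star_eq
  obtain ⟨hΦd, hΦb, hreal⟩ := vacSlice_clauses G (W := W) (E := E) (T := T) (Ψ := Ψ) (κ := κ) hσ hiso hfixρ ha hd hsR hB
    hpbar hhol hsup hkp2 hdec hpin hΨv hexplZ hp₀
  have hlast := lastCouplingLipschitz_of_couplingTwoPoint_room G h0 hAdm hres hadd hloc hstep hfac hsmul hne hwt hτ hτbar hω
    hωh hωωh ha hd hs₀ hsR hB hpbar hθ1 hhol hsup hkp2 hdec hpin hΨv hexplZ hp₀ hclip0 hCup hqT0 hTcup hroom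
  have hϱ : 0 < R₀ - s₀ := sub_pos.mpr hsR; have hclipbar : 0 ≤ clipbar := (hclip0 0).trans (hclipb 0)
  have hqTbar : 0 ≤ qTbar := (hqT0 0).trans (hqTb 0); have hc : 0 ≤ 2 * B / (R₀ - s₀) := by positivity
  have hℓ : 0 ≤ 8 * clipbar * B + 2 * B / (R₀ - s₀) * qTbar := by positivity
  have hlam : ∀ k, 8 * clip k * B + 2 * B / (R₀ - s₀) * qT k ≤ 8 * clipbar * B + 2 * B / (R₀ - s₀) * qTbar := fun k =>
    add_le_add (by gcongr; exact hclipb k) (mul_le_mul_of_nonneg_left (hqTb k) hc)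
  exact ne9_and_fadingMemory_of_holoSlice_sharp_SP h0 hAdm hres hadd hloc hstep hfac hlast hsmul hne hwt hτ hτbar hω hωh hωωh
    hs₀ (by positivity) hθ0 hθ1 hℓ hΦd hΦb hreal hroom hlam

end Room

/-! ## §5 At the record's own new-term map `NE9EndApplied.ΨOf` (shape by `rfl`) -/

section Record

open Summit.QuantumFields.BalabanUV.T4Continuum.NE9EndApplied
open Summit.QuantumFields.BalabanUV.T4Continuum.NE9ComplexEncoding (doubleCarriers)

variable {C₀ : Carriers} {E : Type} {ι : Type}

omit G in
/-- **ROUTE R4♯'s END AT THE RECORD's OWN NEW-TERM MAP `ΨOf`, COUPLING HALF DERIVED** — §4 at `Ψ := NE9EndApplied.ΨOf G act wt U₀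
explZ` (`hΨv` by `psiOf_eq_vac`, `rfl`): for ANY functional `Ef` on the re∕im-doubled carriers factorising through a channel `T` with this
new-term map (e.g. `EfOf …`, `factorises_EfOf`), pencil + coupling two-point + channel coupling modulus + `hexplZ` + structural binders +
ROOM ⇒ `NE9 Ef W κ (prodModuli ((1∕(1−θ²))·(8·clipbar·B + 2·B∕(R₀ − s₀)·qTbar)) (fun _ => θ)) ∧ FadingMemory …`.  The R4 counterpart of
leaf-06's R3′ record END `…_couplingTwoPoint_vacSub_sizeInduction_psiOf` — same letters MINUS `hbase`∕`hNsucc`∕`hNnn`∕`hbox`∕`h𝒜`∕`hρ`,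
PLUS the room.  «NE9 ⇐ the named binders»; nothing of Bałaban's asserted.
[cite: Balaban1987RG1, (2.13)-(2.14) p.268 and (0.23) p.256; Balaban1988RG2Cluster, (1.33)-(1.36) p.9, Lemma 3 (2.38) p.20, (2.40)-(2.41) p.21; FV1980, ch.V §5] -/
theorem ne9_and_fadingMemory_of_pencil_coupling_psiOf_SP [Nonempty ι] (G : ClusterGeom (doubleCarriers C₀))
    {Ef : Functional (doubleCarriers C₀) E} {W : Set (ℕ → ℝ)} {Adm : Set (E → (doubleCarriers C₀).Dom → ℝ)}
    {T : ℕ → (ℕ → ℝ) → (E → (doubleCarriers C₀).Dom → ℝ) → ι → ℝ} {κ : ℝ} {wt : ℕ → ι → ℝ} {τ : ℕ → ℕ → ℝ}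
    {τbar ω ωh : ℝ} {act : ℕ → ℝ → E → lp (fun _ : ι => ℂ) ∞ → G.P → ℂ} {U₀ : E}
    {explZ : ℕ → E → (doubleCarriers C₀).Dom → ℝ}
    (h0 : ∀ g ∈ W, ∀ (U : E) (X : (doubleCarriers C₀).Dom), (doubleCarriers C₀).scale X = 0 → Ef g U X = 0)
    (hAdm : AdmissibleTerms Ef W Adm) (hres : AdmRestrict Adm) (hadd : ChannelAdditive Adm T) (hloc : ChannelLocal Adm T)
    (hstep : ChannelSizeAtStepNN Adm T κ wt τ) (hfac : Factorises Ef W T (ΨOf G act wt U₀ explZ))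
    (hsmul : ∀ (c : ℝ), ∀ H ∈ Adm, c • H ∈ Adm) (hne : Adm.Nonempty) (hwt : ∀ m y, 0 < wt m y)
    (hτ : ∀ k j, j ≤ k → 0 ≤ τ k j ∧ τ k j ≤ τbar * ω ^ (k - j)) (hτbar : 0 < τbar) (hω : 0 ≤ ω) (hωh : 0 < ωh)
    (hωωh : ω ≤ ωh) {m : ℕ → ℝ → E → G.P → ℝ} {a d : G.P → ℝ} {δ : (doubleCarriers C₀).Dom → ℝ}
    {p₀ clip qT : ℕ → ℝ} {R₀ s₀ B pbar θ clipbar qTbar : ℝ}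
    (ha : ∀ γ, 0 ≤ a γ) (hd : ∀ γ, 0 ≤ d γ) (hs₀ : 0 < s₀) (hsR : s₀ < R₀)
    (hB : 0 ≤ B) (hpbar : 0 ≤ pbar) (hθ0 : 0 < θ) (hθ1 : θ < 1)
    (hhol : ∀ g ∈ W, ∀ (k : ℕ) (U : E) (X : (doubleCarriers C₀).Dom), (doubleCarriers C₀).scale X = k + 1 →
      ∀ γ ∈ G.vol X, LineHolo (fun Q => act k (g k) U Q γ) R₀)
    (hsup : ∀ g ∈ W, ∀ (k : ℕ) (U : E) (X : (doubleCarriers C₀).Dom), (doubleCarriers C₀).scale X = k + 1 →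
      ∀ Q ∈ ball (0 : lp (fun _ : ι => ℂ) ∞) R₀, ∀ γ ∈ G.vol X, ‖act k (g k) U Q γ‖ ≤ m k (g k) U γ)
    (hkp2 : ∀ g ∈ W, ∀ (k : ℕ) (U : E) (X : (doubleCarriers C₀).Dom), (doubleCarriers C₀).scale X = k + 1 →
      ∀ γ ∈ G.vol X, ∑ γ' ∈ G.vol X with G.inc γ' γ, 2 * m k (g k) U γ' * Real.exp (a γ' + d γ') ≤ a γ)
    (hdec : G.DecayExtract δ d) (hpin : G.PinBudget a δ (fun _ => B) κ)
    (hexplZ : ∀ (k : ℕ) (U : E) (X : (doubleCarriers C₀).Dom), (doubleCarriers C₀).scale X = k + 1 →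
      |explZ k U X| ≤ Real.exp (-(κ * (doubleCarriers C₀).d X)) * p₀ k)
    (hp₀ : ∀ k, p₀ k ≤ pbar) (hclip0 : ∀ k, 0 ≤ clip k) (hclipb : ∀ k, clip k ≤ clipbar)
    (hCup : ∀ g ∈ W, ∀ g' ∈ W, ∀ (k : ℕ) (U : E) (X : (doubleCarriers C₀).Dom), (doubleCarriers C₀).scale X = k + 1 →
      ∀ Q ∈ ball (0 : lp (fun _ : ι => ℂ) ∞) s₀, ∀ γ ∈ G.vol X,
        ‖act k (g k) U Q γ‖ ≤ m k (g' k) U γ ∧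
          ‖act k (g k) U Q γ - act k (g' k) U Q γ‖ ≤ clip k * |g k - g' k| * m k (g' k) U γ)
    (hqT0 : ∀ k, 0 ≤ qT k) (hqTb : ∀ k, qT k ≤ qTbar)
    (hTcup : ∀ g ∈ W, ∀ g' ∈ W, ∀ (k : ℕ) (y : ι),
      |T k g (Ef g) y - T k g' (Ef g) y| ≤ wt k y * (qT k * |g k - g' k|))
    (hroom : ωh * s₀ + τbar * (2 * B + pbar) ≤ θ * s₀) :
    NE9 Ef W κ (prodModuli (1 / (1 - θ ^ 2) * (8 * clipbar * B + 2 * B / (R₀ - s₀) * qTbar)) fun _ => θ) ∧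
      FadingMemory (1 / (1 - θ ^ 2) * (8 * clipbar * B + 2 * B / (R₀ - s₀) * qTbar) / θ) θ
        (prodModuli (1 / (1 - θ ^ 2) * (8 * clipbar * B + 2 * B / (R₀ - s₀) * qTbar)) fun _ => θ) :=
  ne9_and_fadingMemory_of_pencil_coupling_SP_vac G h0 hAdm hres hadd hloc hstep hfac hsmul hne hwt hτ hτbar hω hωh hωωh
    ha hd hs₀ hsR hB hpbar hθ0 hθ1 hhol hsup hkp2 hdec hpin (fun k s Q U X => psiOf_eq_vac G act wt U₀ explZ k s Q U X)
    hexplZ hp₀ hclip0 hclipb hCup hqT0 hqTb hTcup hroom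

end Record

end Summit.QuantumFields.BalabanUV.T4Continuum.NE9HoloFamilyCoupledEnd

end
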